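import Mathlib
import Literature.Analysis.SpecialFunctions.LegendrePolynomials

/-!
# Legendre polynomials: parity, Bonnet's recursion, `P_n(±1)`

Proved continuation of `Literature/Analysis/SpecialFunctions/LegendrePolynomials.lean`, which
defines `legendre n ∈ ℝ[X]` by Rodrigues' formula `P_n = (2ⁿ n!)⁻¹ dⁿ/dxⁿ (x² - 1)ⁿ` and proves
`deg P_n = n`, the leading coefficient `p_n = (2n)!/(2ⁿ(n!)²)`, the orthogonality
`∫_{-1}^1 P_n q = 0` (`deg q < n`) and the norm `∫_{-1}^1 P_n² = 2/(2n+1)`. From these alone: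

* `legendre_comp_neg_X`, `eval_neg_legendre`: **parity** `P_n(-x) = (-1)ⁿ P_n(x)` (`(x²-1)ⁿ` is
  even and each derivative flips the sign under `x ↦ -x`, `iterate_derivative_comp_neg_X`);
* `legendreLead_succ`: `p_{n+1} = (2n+1)/(n+1) · p_n`;
* `exists_eq_sum_C_mul_legendre`, `eq_zero_of_orthogonal_legendre`: every polynomial of degree
  `≤ n` is a combination of `P_0, …, P_n`, and **a polynomial of degree `≤ n` orthogonal to
  `P_0, …, P_n` on `[-1, 1]` is zero**;
* `integral_X_mul_legendre_mul_legendre_eq_zero` (`k + 1 < n`),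
  `integral_X_mul_legendre_succ_mul_legendre` (`∫ x P_{n+1} P_n = (p_n/p_{n+1}) · 2/(2n+3)`),
  `integral_X_mul_legendre_sq` (`∫ x P_n² = 0`, odd integrand): the three integrals `∫ x P_n P_k`;
* `legendre_succ_succ`, `legendre_add_two`: **Bonnet's recursion**
  `(n+2) P_{n+2} = (2n+3) X P_{n+1} - (n+1) P_n` — the remainder
  `(2n+3) X P_{n+1} - (n+2) P_{n+2} - (n+1) P_n` has degree `≤ n + 1` (leading coefficients cancel)
  and is orthogonal to `P_0, …, P_{n+1}`, hence vanishes (the three-term recurrence of orthogonal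
  polynomials, here with the classical constants; Jeffrey, *Handbook of Mathematical Formulas and
  Integrals*, §18.2.5.1 (1): `(n+1)P_{n+1}(x) = (2n+1)xP_n(x) - nP_{n-1}(x)`);
* `eval_one_legendre`, `eval_neg_one_legendre`: `P_n(1) = 1`, `P_n(-1) = (-1)ⁿ` (§18.2.4.1,
  "Normalization").

Motivation: the kernel `Q_{s-1}` of the higher Green functions
(`Literature/NumberTheory/Automorphic/HigherGreenFunction*.lean`) satisfies the same recursion
(`greenQ_three_term`), whence the closed form `Q_n = P_n Q_0 - W_{n-1}`.

## References

* A. Jeffrey, *Handbook of Mathematical Formulas and Integrals*, Academic Press 1995,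
  doi:10.1016/c2009-0-21270-0, §18.2.4.1 and §18.2.5.1. [`Jeffrey1995`]
* G. E. Andrews, R. Askey, R. Roy, *Special Functions*, CUP 1999, §2.5 (Rodrigues' formula,
  orthogonality), as in `LegendrePolynomials.lean`. [`AndrewsAskeyRoy1999`]
-/

noncomputable section

open Polynomial intervalIntegral MeasureTheory Finset
open scoped Nat

namespace Literature.Analysis.SpecialFunctions

/-! ### Parity `P_n(-x) = (-1)ⁿ P_n(x)` -/

/-- `d^k (p ∘ (-X)) = (-1)^k (d^k p) ∘ (-X)`. [folklore] -/
theorem iterate_derivative_comp_neg_X (p : ℝ[X]) (k : ℕ) :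
    derivative^[k] (p.comp (-X)) = C ((-1 : ℝ) ^ k) * (derivative^[k] p).comp (-X) := by
  induction k with
  | zero => simp
  | succ k ih =>
    rw [Function.iterate_succ_apply', ih, derivative_C_mul, derivative_comp, derivative_neg,
      derivative_X, Function.iterate_succ_apply', pow_succ, C_mul]
    simp only [map_neg, map_one]
    ring

/-- `W_n = (X² - 1)ⁿ` is even. [folklore] -/
theorem legendreW_comp_neg_X (n : ℕ) : (legendreW n).comp (-X) = legendreW n := by
  simp [legendreW, sub_comp]

/-- **Parity of the Legendre polynomials**: `P_n ∘ (-X) = (-1)ⁿ P_n`. [folklore] -/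
theorem legendre_comp_neg_X (n : ℕ) : (legendre n).comp (-X) = C ((-1 : ℝ) ^ n) * legendre n := by
  have h := iterate_derivative_comp_neg_X (legendreW n) n
  rw [legendreW_comp_neg_X] at h
  -- `(d^n W) ∘ (-X) = (-1)^n d^n W`
  have h2 : (derivative^[n] (legendreW n)).comp (-X) = C ((-1 : ℝ) ^ n) * derivative^[n] (legendreW n) := by
    have hc : C ((-1 : ℝ) ^ n) * C ((-1 : ℝ) ^ n) = (1 : ℝ[X]) := by
      rw [← C_mul, ← mul_pow]; norm_num
    calc (derivative^[n] (legendreW n)).comp (-X)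
        = (C ((-1 : ℝ) ^ n) * C ((-1 : ℝ) ^ n)) * (derivative^[n] (legendreW n)).comp (-X) := by
          rw [hc, one_mul]
      _ = C ((-1 : ℝ) ^ n) * (C ((-1 : ℝ) ^ n) * (derivative^[n] (legendreW n)).comp (-X)) := by ring
      _ = C ((-1 : ℝ) ^ n) * derivative^[n] (legendreW n) := by rw [← h]
  rw [legendre, mul_comp, C_comp, h2]
  ring

/-- `P_n(-x) = (-1)ⁿ P_n(x)`. [folklore] -/
theorem eval_neg_legendre (n : ℕ) (x : ℝ) :
    (legendre n).eval (-x) = (-1) ^ n * (legendre n).eval x := by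
  have h := congrArg (fun q => q.eval x) (legendre_comp_neg_X n)
  simpa [eval_comp] using h

/-! ### The leading coefficients: `p_{n+1} = (2n+1)/(n+1) · p_n` -/

/-- `p_{n+1} = ((2n+1)/(n+1)) p_n`. [folklore] -/
theorem legendreLead_succ (n : ℕ) :
    legendreLead (n + 1) = (2 * n + 1) / (n + 1) * legendreLead n := by
  unfold legendreLead
  rw [show 2 * (n + 1) = (2 * n + 1) + 1 by ring, Nat.factorial_succ, Nat.factorial_succ (2 * n),
    Nat.factorial_succ n]
  push_cast
  have h1 : ((n ! : ℕ) : ℝ) ≠ 0 := by positivity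
  have h2 : (n : ℝ) + 1 ≠ 0 := by positivity
  field_simp
  ring

/-! ### Expansion in the Legendre basis and the uniqueness lemma -/

/-- Every real polynomial of degree `≤ n` is a combination `Σ_{k ≤ n} α_k P_k` (the `P_k` have
exact degree `k`). [folklore] -/
theorem exists_eq_sum_C_mul_legendre (n : ℕ) : ∀ R : ℝ[X], R.natDegree ≤ n →
    ∃ α : ℕ → ℝ, R = ∑ k ∈ range (n + 1), C (α k) * legendre k := by
  induction n with
  | zero =>
    intro R hR
    refine ⟨fun _ => R.coeff 0, ?_⟩
    rw [sum_range_one, legendre_zero, mul_one]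
    exact eq_C_of_natDegree_le_zero hR
  | succ n ih =>
    intro R hR
    have hp : legendreLead (n + 1) ≠ 0 := (legendreLead_pos _).ne'
    set β : ℝ := R.coeff (n + 1) / legendreLead (n + 1) with hβ
    set R' : ℝ[X] := R - C β * legendre (n + 1) with hR'
    have hR'deg : R'.natDegree ≤ n := by
      rw [natDegree_le_iff_coeff_eq_zero]
      intro m hm
      rw [hR', coeff_sub, coeff_C_mul]
      rcases eq_or_lt_of_le (Nat.succ_le_of_lt hm) with h | h
      · rw [← h, coeff_legendre_self, hβ]
        field_simp
        ring
      · rw [coeff_eq_zero_of_natDegree_lt (lt_of_le_of_lt hR h),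
          coeff_eq_zero_of_natDegree_lt (by rw [natDegree_legendre]; exact h)]
        ring
    obtain ⟨α', hα'⟩ := ih R' hR'deg
    refine ⟨fun k => if k = n + 1 then β else α' k, ?_⟩
    rw [sum_range_succ,
      show (fun k => if k = n + 1 then β else α' k) (n + 1) = β from if_pos rfl]
    have hsum : ∑ k ∈ range (n + 1), C ((fun k => if k = n + 1 then β else α' k) k) * legendre k =
        ∑ k ∈ range (n + 1), C (α' k) * legendre k :=
      sum_congr rfl fun k hk => by
        rw [mem_range] at hk
        simp [hk.ne]
    rw [hsum, ← hα', hR']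
    ring

/-- **A polynomial of degree `≤ n` orthogonal to `P_0, …, P_n` on `[-1, 1]` vanishes** (expand in
the Legendre basis; `∫ P_k P_j = 0` for `k ≠ j` and `∫ P_j² = 2/(2j+1) ≠ 0`). [folklore] -/
theorem eq_zero_of_orthogonal_legendre {n : ℕ} {R : ℝ[X]} (hR : R.natDegree ≤ n)
    (horth : ∀ k ≤ n, ∫ x in (-1 : ℝ)..1, R.eval x * (legendre k).eval x = 0) : R = 0 := by
  obtain ⟨α, hα⟩ := exists_eq_sum_C_mul_legendre n R hR
  have hαj : ∀ j ≤ n, α j = 0 := by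
    intro j hj
    have h := horth j hj
    rw [hα] at h
    have hexp : ∫ x in (-1 : ℝ)..1, (∑ k ∈ range (n + 1), C (α k) * legendre k).eval x *
        (legendre j).eval x =
        ∑ k ∈ range (n + 1), α k * ∫ x in (-1 : ℝ)..1, (legendre k).eval x * (legendre j).eval x := by
      simp only [eval_finsetSum, eval_mul, eval_C, sum_mul]
      rw [intervalIntegral.integral_finsetSum]
      · refine sum_congr rfl fun k _ => ?_
        rw [← intervalIntegral.integral_const_mul]
        refine intervalIntegral.integral_congr fun x _ => ?_
        ring
      · intro k _
        exact ((continuous_const.mul (legendre k).continuous).mul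
          (legendre j).continuous).intervalIntegrable _ _
    rw [hexp, sum_eq_single j] at h
    · have hsq : ∫ x in (-1 : ℝ)..1, (legendre j).eval x * (legendre j).eval x = 2 / (2 * j + 1) := by
        rw [← integral_legendre_sq j]
        exact intervalIntegral.integral_congr fun x _ => by ring
      rw [hsq] at h
      have hpos : (0 : ℝ) < 2 / (2 * j + 1) := by positivity
      exact (mul_eq_zero.mp h).resolve_right hpos.ne'
    · intro k _ hkj
      rcases lt_or_gt_of_ne hkj with hlt | hgt
      · rw [show (∫ x in (-1 : ℝ)..1, (legendre k).eval x * (legendre j).eval x) =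
            ∫ x in (-1 : ℝ)..1, (legendre j).eval x * (legendre k).eval x from
            intervalIntegral.integral_congr fun x _ => by ring,
          integral_legendre_mul_legendre_eq_zero hlt, mul_zero]
      · rw [integral_legendre_mul_legendre_eq_zero hgt, mul_zero]
    · intro hj'
      exact absurd (mem_range.mpr (by omega)) hj'
  rw [hα]
  exact sum_eq_zero fun k hk => by
    rw [hαj k (by rw [mem_range] at hk; omega), C_0, zero_mul]

/-! ### The three integrals `∫ x P_n P_k` -/

/-- `∫_{-1}^1 x P_n(x) P_k(x) dx = 0` for `k + 1 < n` (`deg (X P_k) < n`). [folklore] -/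
theorem integral_X_mul_legendre_mul_legendre_eq_zero {n k : ℕ} (hk : k + 1 < n) :
    ∫ x in (-1 : ℝ)..1, x * (legendre n).eval x * (legendre k).eval x = 0 := by
  have h1 : (X * legendre k).natDegree ≤ k + 1 := by
    refine natDegree_mul_le.trans ?_
    rw [natDegree_legendre]
    have := natDegree_X_le (R := ℝ)
    omega
  have hdeg : (X * legendre k).degree < (n : WithBot ℕ) :=
    (degree_le_of_natDegree_le h1).trans_lt (by exact_mod_cast hk)
  rw [← integral_legendre_mul_eq_zero hdeg]
  refine intervalIntegral.integral_congr fun x _ => ?_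
  simp only [eval_mul, eval_X]
  ring

/-- `∫_{-1}^1 x P_{n+1}(x) P_n(x) dx = (p_n/p_{n+1}) · 2/(2n+3)`: `X P_n = (p_n/p_{n+1}) P_{n+1} + `
(degree `≤ n`). [folklore] -/
theorem integral_X_mul_legendre_succ_mul_legendre (n : ℕ) :
    ∫ x in (-1 : ℝ)..1, x * (legendre (n + 1)).eval x * (legendre n).eval x =
      legendreLead n / legendreLead (n + 1) * (2 / (2 * (n + 1 : ℕ) + 1)) := by
  have hp : legendreLead (n + 1) ≠ 0 := (legendreLead_pos _).ne'
  set r : ℝ := legendreLead n / legendreLead (n + 1) with hr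
  set S : ℝ[X] := X * legendre n - C r * legendre (n + 1) with hS
  have hXP : (X * legendre n).natDegree ≤ n + 1 := by
    refine natDegree_mul_le.trans ?_
    rw [natDegree_legendre]
    have := natDegree_X_le (R := ℝ)
    omega
  have hSdeg : S.degree < ((n + 1 : ℕ) : WithBot ℕ) := by
    have h1 : S.natDegree ≤ n := by
      rw [natDegree_le_iff_coeff_eq_zero]
      intro m hm
      rw [hS, coeff_sub, coeff_C_mul]
      rcases eq_or_lt_of_le (Nat.succ_le_of_lt hm) with h | h
      · rw [← h, coeff_X_mul, coeff_legendre_self, coeff_legendre_self, hr]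
        field_simp
        ring
      · rw [coeff_eq_zero_of_natDegree_lt (hXP.trans_lt h),
          coeff_eq_zero_of_natDegree_lt (by rw [natDegree_legendre]; exact h)]
        ring
    exact (degree_le_of_natDegree_le h1).trans_lt (by exact_mod_cast Nat.lt_succ_self n)
  have horth := integral_legendre_mul_eq_zero hSdeg
  have hsq := integral_legendre_sq (n + 1)
  -- `x P_{n+1} P_n = P_{n+1} (r P_{n+1} + S)`
  have hpt : ∀ x : ℝ, x * (legendre (n + 1)).eval x * (legendre n).eval x =
      r * (legendre (n + 1)).eval x ^ 2 + (legendre (n + 1)).eval x * S.eval x := by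
    intro x
    simp only [hS, eval_sub, eval_mul, eval_X, eval_C]
    ring
  simp_rw [hpt]
  rw [intervalIntegral.integral_add, intervalIntegral.integral_const_mul, hsq, horth, add_zero]
  · exact (continuous_const.mul ((legendre (n + 1)).continuous.pow 2)).intervalIntegrable _ _
  · exact ((legendre (n + 1)).continuous.mul S.continuous).intervalIntegrable _ _

/-- `∫_{-1}^1 x P_n(x)² dx = 0` (odd integrand, by parity). [folklore] -/
theorem integral_X_mul_legendre_sq (n : ℕ) :
    ∫ x in (-1 : ℝ)..1, x * (legendre n).eval x * (legendre n).eval x = 0 := by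
  have h := intervalIntegral.integral_comp_neg (a := (-1 : ℝ)) (b := 1)
    (f := fun x => x * (legendre n).eval x * (legendre n).eval x)
  simp only [neg_neg] at h
  have hsq : ((-1 : ℝ) ^ n) ^ 2 = 1 := by
    rw [← pow_mul, mul_comm, pow_mul]
    norm_num
  have h2 : (fun x : ℝ => -x * (legendre n).eval (-x) * (legendre n).eval (-x)) =
      fun x => -(x * (legendre n).eval x * (legendre n).eval x) := by
    funext x
    rw [eval_neg_legendre]
    linear_combination (-(x * (legendre n).eval x * (legendre n).eval x)) * hsq
  rw [h2, intervalIntegral.integral_neg] at h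
  linarith

/-! ### Bonnet's recursion -/

/-- **Bonnet's recursion for the Legendre polynomials** (Rodrigues' `P_n`):
`(n+2) P_{n+2} = (2n+3) X P_{n+1} - (n+1) P_n` for all `n ≥ 0`. Proof: the polynomial
`R = (2n+3) X P_{n+1} - (n+2) P_{n+2} - (n+1) P_n` has degree `≤ n + 1` (the `X^{n+2}`-coefficients
cancel, `p_{n+2} = (2n+3)/(n+2) · p_{n+1}`) and is orthogonal to `P_0, …, P_{n+1}` on `[-1, 1]`
(orthogonality of the `P_k`, `∫ x P_{n+1} P_n = (p_n/p_{n+1}) ‖P_{n+1}‖²`, and `∫ x P_{n+1}² = 0`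
by parity), hence vanishes (`eq_zero_of_orthogonal_legendre`).
[cite: Jeffrey1995, §18.2.5.1 (1)] -/
theorem legendre_succ_succ (n : ℕ) :
    C ((n : ℝ) + 2) * legendre (n + 2) =
      C (2 * (n : ℝ) + 3) * X * legendre (n + 1) - C ((n : ℝ) + 1) * legendre n := by
  set R : ℝ[X] := C (2 * (n : ℝ) + 3) * X * legendre (n + 1) - C ((n : ℝ) + 2) * legendre (n + 2) -
    C ((n : ℝ) + 1) * legendre n with hR
  suffices hR0 : R = 0 by
    rw [hR] at hR0
    linear_combination -hR0
  have hXP : (X * legendre (n + 1)).natDegree ≤ n + 2 := by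
    refine natDegree_mul_le.trans ?_
    rw [natDegree_legendre]
    have := natDegree_X_le (R := ℝ)
    omega
  apply eq_zero_of_orthogonal_legendre (n := n + 1)
  · -- degree `≤ n + 1`
    rw [natDegree_le_iff_coeff_eq_zero]
    intro N hN
    rw [hR, coeff_sub, coeff_sub, mul_assoc, coeff_C_mul, coeff_C_mul, coeff_C_mul]
    obtain ⟨N', rfl⟩ : ∃ N', N = N' + 1 := ⟨N - 1, by omega⟩
    rw [coeff_X_mul]
    rcases eq_or_lt_of_le (show n + 1 ≤ N' by omega) with h | h
    · -- the leading coefficients cancel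
      rw [← h, coeff_legendre_self, coeff_legendre_self,
        coeff_eq_zero_of_natDegree_lt (by rw [natDegree_legendre]; omega), mul_zero, sub_zero,
        legendreLead_succ (n + 1)]
      push_cast
      field_simp
      ring
    · rw [coeff_eq_zero_of_natDegree_lt (by rw [natDegree_legendre]; omega),
        coeff_eq_zero_of_natDegree_lt (by rw [natDegree_legendre]; omega),
        coeff_eq_zero_of_natDegree_lt (by rw [natDegree_legendre]; omega)]
      ring
  · -- orthogonality to `P_k`, `k ≤ n + 1`
    intro k hk
    have hI1 : IntervalIntegrable (fun x : ℝ => x * (legendre (n + 1)).eval x * (legendre k).eval x)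
        volume (-1) 1 :=
      ((continuous_id.mul (legendre (n + 1)).continuous).mul (legendre k).continuous).intervalIntegrable _ _
    have hI2 : IntervalIntegrable (fun x : ℝ => (legendre (n + 2)).eval x * (legendre k).eval x)
        volume (-1) 1 :=
      ((legendre (n + 2)).continuous.mul (legendre k).continuous).intervalIntegrable _ _
    have hI3 : IntervalIntegrable (fun x : ℝ => (legendre n).eval x * (legendre k).eval x)
        volume (-1) 1 :=
      ((legendre n).continuous.mul (legendre k).continuous).intervalIntegrable _ _
    have hexp : ∫ x in (-1 : ℝ)..1, R.eval x * (legendre k).eval x =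
        (2 * (n : ℝ) + 3) * (∫ x in (-1 : ℝ)..1, x * (legendre (n + 1)).eval x * (legendre k).eval x) -
        ((n : ℝ) + 2) * (∫ x in (-1 : ℝ)..1, (legendre (n + 2)).eval x * (legendre k).eval x) -
        ((n : ℝ) + 1) * (∫ x in (-1 : ℝ)..1, (legendre n).eval x * (legendre k).eval x) := by
      rw [← intervalIntegral.integral_const_mul, ← intervalIntegral.integral_const_mul,
        ← intervalIntegral.integral_const_mul, ← intervalIntegral.integral_sub (hI1.const_mul _) (hI2.const_mul _),
        ← intervalIntegral.integral_sub ((hI1.const_mul _).sub (hI2.const_mul _)) (hI3.const_mul _)]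
      refine intervalIntegral.integral_congr fun x _ => ?_
      simp only [hR, eval_sub, eval_mul, eval_C, eval_X]
      ring
    rw [hexp]
    rcases Nat.lt_or_ge k n with hlt | hge
    · -- `k < n`: all three integrals vanish
      rw [integral_X_mul_legendre_mul_legendre_eq_zero (by omega),
        integral_legendre_mul_legendre_eq_zero (show k < n + 2 by omega),
        integral_legendre_mul_legendre_eq_zero hlt]
      ring
    · rcases (show k = n ∨ k = n + 1 by omega) with rfl | rfl
      · -- `k = n`
        rw [integral_X_mul_legendre_succ_mul_legendre k,
          integral_legendre_mul_legendre_eq_zero (show k < k + 2 by omega)]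
        have hsq : ∫ x in (-1 : ℝ)..1, (legendre k).eval x * (legendre k).eval x = 2 / (2 * k + 1) := by
          rw [← integral_legendre_sq k]
          exact intervalIntegral.integral_congr fun x _ => by ring
        rw [hsq, legendreLead_succ k]
        have hp : legendreLead k ≠ 0 := (legendreLead_pos k).ne'
        push_cast
        field_simp
        ring
      · -- `k = n + 1`
        rw [integral_X_mul_legendre_sq (n + 1),
          integral_legendre_mul_legendre_eq_zero (show n + 1 < n + 2 by omega),
          show (∫ x in (-1 : ℝ)..1, (legendre n).eval x * (legendre (n + 1)).eval x) =
            ∫ x in (-1 : ℝ)..1, (legendre (n + 1)).eval x * (legendre n).eval x from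
            intervalIntegral.integral_congr fun x _ => by ring,
          integral_legendre_mul_legendre_eq_zero (show n < n + 1 by omega)]
        ring

/-- Bonnet's recursion, solved for `P_{n+2}`. [cite: Jeffrey1995, §18.2.5.1 (1)] -/
theorem legendre_add_two (n : ℕ) :
    legendre (n + 2) =
      C ((2 * (n : ℝ) + 3) / (n + 2)) * X * legendre (n + 1) - C (((n : ℝ) + 1) / (n + 2)) * legendre n := by
  have h := legendre_succ_succ n
  have hn : (n : ℝ) + 2 ≠ 0 := by positivity
  have e1 : C ((2 * (n : ℝ) + 3) / (n + 2)) = C ((n : ℝ) + 2)⁻¹ * C (2 * (n : ℝ) + 3) := by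
    rw [← C_mul]; congr 1; field_simp
  have e2 : C (((n : ℝ) + 1) / (n + 2)) = C ((n : ℝ) + 2)⁻¹ * C ((n : ℝ) + 1) := by
    rw [← C_mul]; congr 1; field_simp
  calc legendre (n + 2) = C ((n : ℝ) + 2)⁻¹ * (C ((n : ℝ) + 2) * legendre (n + 2)) := by
        rw [← mul_assoc, ← C_mul, inv_mul_cancel₀ hn, C_1, one_mul]
    _ = C ((n : ℝ) + 2)⁻¹ * (C (2 * (n : ℝ) + 3) * X * legendre (n + 1) - C ((n : ℝ) + 1) * legendre n) := by
        rw [h]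
    _ = _ := by rw [e1, e2]; ring

/-- **`P_n(1) = 1`.** [cite: Jeffrey1995, §18.2.4.1] -/
theorem eval_one_legendre (n : ℕ) : (legendre n).eval 1 = 1 := by
  induction n using Nat.twoStepInduction with
  | zero => simp [legendre_zero]
  | one => simp [legendre_one]
  | more n ih0 ih1 =>
    rw [legendre_add_two]
    simp only [eval_sub, eval_mul, eval_C, eval_X, ih0, ih1, mul_one]
    have hn : (n : ℝ) + 2 ≠ 0 := by positivity
    field_simp
    ring

/-- `P_n(-1) = (-1)ⁿ`. [cite: Jeffrey1995, §18.2.4.1] -/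
theorem eval_neg_one_legendre (n : ℕ) : (legendre n).eval (-1) = (-1) ^ n := by
  rw [eval_neg_legendre, eval_one_legendre, mul_one]

end Literature.Analysis.SpecialFunctions
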